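import Summits.AtomisticToContinuum.Crystallization.Theorems.PalmUnimodularRigidityShellsToBarlowChartDefs
import Summits.AtomisticToContinuum.Crystallization.Theorems.PalmUnimodularRigidityShellsToBarlowChartTransportDefs
import Summits.AtomisticToContinuum.Crystallization.Theorems.ShellsToBarlowChart.Negative.HaggWord

/-!
# `stub_developCovering` for line `develop-the-model-growth-descent`
# (crux `ShellsToBarlowChart`, stmt-AtomisticToContinuum-9227)

## Worker log
* algebra of commuting permutations (`zpow_apply_comm_of_comm`, `apply_zpow_eq_of_invariant`,
  `frame_shift`, `par_frame`), injectivity of the site parametrisation, `contacts` in relative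
  coordinates, the bookkeeping theorem `isBondCovering_of_frames`, and the stub.

The ALGEBRAIC half of the model covering: a transport system on `S` (three commuting
permutations `I, J, V` of a frame type with a point map `pt`, an `I, J`-invariant parity `par`,
reachability from a base frame `f₀`, and the STAR / LINK clauses in the relative coordinates
`linkOffsets` / `linkAdj` of `BarlowRings.lean`) yields the Hägg word `s k := par (V^k f₀)` and the
bond covering `Ψ (barlowPos 1 √(2/3) s k i j) := pt (V^k (J^j (I^i f₀)))` of `S` by the model
`barlowStacking 1 √(2/3) s`: onto (reachability), star-bijective (STAR clause transported along
`relPos`, `touching_iff_exists_linkOffsets`) and link-faithful (LINK clause and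
`dist_relPos_eq_iff_linkAdj`).
-/

noncomputable section

namespace Summit.AtomisticToContinuum.Crystallization.Theorems.PalmUnimodularRigidityShellsToBarlowChart

open Literature.Geometry.DiscreteGeometry Literature.MathematicalPhysics.StatisticalMechanics
open Summit.AtomisticToContinuum.Crystallization.Theorems.ShellsToBarlowChartNegative

/-- Euclidean `3`-space. -/
local notation "E3" => EuclideanSpace ℝ (Fin 3)

namespace DevelopCovering

/-! ## Commuting permutations: integer powers -/

/-- Pointwise-commuting permutations have pointwise-commuting integer powers. [folklore] -/
theorem zpow_apply_comm_of_comm {F : Type*} {A B : Equiv.Perm F} (hAB : ∀ f, A (B f) = B (A f))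
    (m n : ℤ) (f : F) : (A ^ m) ((B ^ n) f) = (B ^ n) ((A ^ m) f) := by
  have hc : Commute A B := Equiv.ext fun g => by
    rw [Equiv.Perm.mul_apply, Equiv.Perm.mul_apply]
    exact hAB g
  have h2 := congrArg (fun g : Equiv.Perm F => g f) (hc.zpow_zpow m n).eq
  simpa only [Equiv.Perm.mul_apply] using h2

/-- Two integer powers of one permutation compose to the power of the sum. [folklore] -/
theorem zpow_apply_zpow_apply {F : Type*} (A : Equiv.Perm F) (m n : ℤ) (f : F) :
    (A ^ m) ((A ^ n) f) = (A ^ (n + m)) f := by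
  rw [add_comm, zpow_add, Equiv.Perm.mul_apply]

/-- The inverse composed with an integer power. [folklore] -/
theorem inv_apply_zpow_apply {F : Type*} (A : Equiv.Perm F) (k : ℤ) (f : F) :
    A⁻¹ ((A ^ k) f) = (A ^ (k - 1)) f := by
  rw [← Equiv.Perm.mul_apply, ← zpow_neg_one, ← zpow_add, neg_add_eq_sub]

/-- A function invariant under a permutation is invariant under all its integer powers.
[folklore] -/
theorem apply_zpow_eq_of_invariant {F : Type*} {A : Equiv.Perm F} {par : F → ℤ}
    (h : ∀ f, par (A f) = par f) (m : ℤ) (f : F) : par ((A ^ m) f) = par f := by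
  induction m using Int.induction_on generalizing f with
  | zero => rw [zpow_zero, Equiv.Perm.one_apply]
  | succ n ih => rw [zpow_add_one, Equiv.Perm.mul_apply, ih, h]
  | pred n ih =>
    rw [zpow_sub_one, Equiv.Perm.mul_apply, ih]
    have h1 := h (A⁻¹ f)
    rw [show A (A⁻¹ f) = f from Equiv.apply_symm_apply A f] at h1
    exact h1.symm

/-- **Frame algebra**: shifting the frame `V^k (J^j (I^i f₀))` by `V^r ∘ J^b ∘ I^a` gives the
frame `V^(k+r) (J^(j+b) (I^(i+a) f₀))` (the three transports commute). [folklore] -/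
theorem frame_shift {F : Type*} {I J V : Equiv.Perm F} (hIJ : ∀ f, I (J f) = J (I f))
    (hIV : ∀ f, I (V f) = V (I f)) (hJV : ∀ f, J (V f) = V (J f)) (f₀ : F)
    (k i j r a b : ℤ) :
    (V ^ r) ((J ^ b) ((I ^ a) ((V ^ k) ((J ^ j) ((I ^ i) f₀))))) =
      (V ^ (k + r)) ((J ^ (j + b)) ((I ^ (i + a)) f₀)) := by
  rw [zpow_apply_comm_of_comm hIV a k, zpow_apply_comm_of_comm hIJ a j,
    zpow_apply_comm_of_comm hJV b k, zpow_apply_zpow_apply I, zpow_apply_zpow_apply J,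
    zpow_apply_zpow_apply V]

/-- **Parity of a frame**: `par (V^k (J^j (I^i f₀))) = par (V^k f₀)` for an `I, J`-invariant
parity and commuting transports. [folklore] -/
theorem par_frame {F : Type*} {I J V : Equiv.Perm F} {par : F → ℤ}
    (hIV : ∀ f, I (V f) = V (I f)) (hJV : ∀ f, J (V f) = V (J f))
    (hparI : ∀ f, par (I f) = par f) (hparJ : ∀ f, par (J f) = par f) (f₀ : F) (k i j : ℤ) :
    par ((V ^ k) ((J ^ j) ((I ^ i) f₀))) = par ((V ^ k) f₀) := by
  rw [← zpow_apply_comm_of_comm hJV j k, ← zpow_apply_comm_of_comm hIV i k,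
    apply_zpow_eq_of_invariant hparJ, apply_zpow_eq_of_invariant hparI]

/-! ## The model: sites and contacts in coordinates -/

/-- The site parametrisation `(k, i, j) ↦ barlowPos a h s k i j` of a Barlow stacking with
`a, h > 0` is injective (uniform discreteness `le_dist_barlowPos`). [folklore] -/
theorem barlowPos_triple_injective {a h : ℝ} (ha : 0 < a) (hh : 0 < h) (s : ℤ → ℤ) :
    Function.Injective (fun t : ℤ × ℤ × ℤ => barlowPos a h s t.1 t.2.1 t.2.2) := by
  intro t t' heq
  by_contra hne
  have hne' : (t.1, t.2.1, t.2.2) ≠ (t'.1, t'.2.1, t'.2.2) := by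
    intro h0
    apply hne
    simp only [Prod.mk.injEq] at h0
    exact Prod.ext h0.1 (Prod.ext h0.2.1 h0.2.2)
  have hle := le_dist_barlowPos a h s ha.le hh.le hne'
  simp only at heq
  rw [heq, dist_self] at hle
  have hmin : 0 < min a h := lt_min ha hh
  linarith

/-- **The contacts of a site in relative coordinates**: the contacts of `barlowPos 1 √(2/3) s k i j`
in the model are the `relPos` images of `linkOffsets (s (k−1)) (s k)`
(`touching_iff_exists_linkOffsets` with `h² = ⅔ · 1²`, `HaggWord.sqrt_two_thirds_sq`). [folklore] -/
theorem contacts_barlowPos_eq_image {s : ℤ → ℤ} (hs : IsHaggSeq s) (k i j : ℤ) :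
    contacts s (barlowPos 1 (Real.sqrt (2 / 3)) s k i j) =
      relPos 1 (Real.sqrt (2 / 3)) s k i j '' ↑(linkOffsets (s (k - 1)) (s k)) := by
  ext w
  simp only [contacts, Set.mem_setOf_eq, Set.mem_image, Finset.mem_coe]
  exact touching_iff_exists_linkOffsets hs one_pos sqrt_two_thirds_sq k i j w

/-- `relPos` in site coordinates. [folklore] -/
theorem relPos_eq_barlowPos (a h : ℝ) (s : ℤ → ℤ) (k i j : ℤ) (x : ℤ × ℤ × ℤ) :
    relPos a h s k i j x = barlowPos a h s (k + x.1) (i - x.2.1) (j - x.2.2) := rfl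

/-! ## From frames to the bond covering -/

/-- **Bookkeeping**: frames `fr (k, i, j)` of the sites with the shift rule
`V^r (J^(−Q) (I^(−P) (fr (k,i,j)))) = fr (k + r, i − P, j − Q)`, parities `par (fr (k,i,j)) = s k`,
`par (V⁻¹ (fr (k,i,j))) = s (k−1)`, and a map `Ψ` with `Ψ (barlowPos 1 √(2/3) s k i j) =
pt (fr (k,i,j))` turn reachability + STAR + LINK of the transport system into a bond covering.
[folklore] -/
theorem isBondCovering_of_frames {S : Set E3} {F : Type*} {pt : F → E3} {I J V : Equiv.Perm F}
    {par : F → ℤ} {s : ℤ → ℤ} {fr : ℤ × ℤ × ℤ → F} {Ψ : E3 → E3} (hs : IsHaggSeq s)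
    (hreach : ∀ y ∈ S, ∃ t, pt (fr t) = y)
    (hstar : ∀ f,
      Set.BijOn (fun x : ℤ × ℤ × ℤ => pt ((V ^ x.1) ((J ^ (-x.2.2)) ((I ^ (-x.2.1)) f))))
        (↑(linkOffsets (par (V⁻¹ f)) (par f)) : Set (ℤ × ℤ × ℤ))
        {y | y ∈ S ∧ (0 < dist (pt f) y ∧ dist (pt f) y ≤ 28 / 25)})
    (hlink : ∀ f, ∀ x ∈ linkOffsets (par (V⁻¹ f)) (par f), ∀ y ∈ linkOffsets (par (V⁻¹ f)) (par f),
        ((0 < dist (pt ((V ^ x.1) ((J ^ (-x.2.2)) ((I ^ (-x.2.1)) f))))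
                (pt ((V ^ y.1) ((J ^ (-y.2.2)) ((I ^ (-y.2.1)) f)))) ∧
          dist (pt ((V ^ x.1) ((J ^ (-x.2.2)) ((I ^ (-x.2.1)) f))))
                (pt ((V ^ y.1) ((J ^ (-y.2.2)) ((I ^ (-y.2.1)) f)))) ≤ 28 / 25) ↔
          linkAdj (par (V⁻¹ f)) (par f) x y))
    (hΨ : ∀ k i j, Ψ (barlowPos 1 (Real.sqrt (2 / 3)) s k i j) = pt (fr (k, i, j)))
    (hΨS : ∀ q, Ψ q ∈ S)
    (hshift : ∀ k i j (x : ℤ × ℤ × ℤ), (V ^ x.1) ((J ^ (-x.2.2)) ((I ^ (-x.2.1)) (fr (k, i, j)))) =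
      fr (k + x.1, i - x.2.1, j - x.2.2))
    (hpar0 : ∀ k i j, par (fr (k, i, j)) = s k)
    (hparm : ∀ k i j, par (V⁻¹ (fr (k, i, j))) = s (k - 1)) :
    IsBondCovering S s Ψ := by
  -- `Ψ ∘ relPos` is the STAR map of the transport system at the frame of the centre
  have hG : ∀ k i j (x : ℤ × ℤ × ℤ), Ψ (relPos 1 (Real.sqrt (2 / 3)) s k i j x) =
      pt ((V ^ x.1) ((J ^ (-x.2.2)) ((I ^ (-x.2.1)) (fr (k, i, j))))) := by
    intro k i j x
    rw [hshift, relPos_eq_barlowPos, hΨ]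
  refine ⟨fun q _ => hΨS q, ?_, ?_, ?_⟩
  · -- onto: reachability
    intro y hy
    obtain ⟨t, ht⟩ := hreach y hy
    refine ⟨barlowPos 1 (Real.sqrt (2 / 3)) s t.1 t.2.1 t.2.2, barlowPos_mem _ _ _, ?_⟩
    rw [hΨ, ← ht]
  · -- star-bijective
    intro p hp
    obtain ⟨k, i, j, rfl⟩ := hp
    have hB := hstar (fr (k, i, j))
    rw [hparm, hpar0] at hB
    rw [hΨ, contacts_barlowPos_eq_image hs]
    refine ⟨?_, ?_, ?_⟩
    · rintro _ ⟨x, hx, rfl⟩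
      rw [hG]
      exact hB.1 hx
    · rintro _ ⟨x, hx, rfl⟩ _ ⟨y, hy, rfl⟩ hxy
      rw [hG, hG] at hxy
      rw [hB.2.1 hx hy hxy]
    · intro w hw
      obtain ⟨x, hx, hGx⟩ := hB.2.2 hw
      exact ⟨relPos 1 (Real.sqrt (2 / 3)) s k i j x, ⟨x, hx, rfl⟩, by rw [hG]; exact hGx⟩
  · -- link-faithful
    intro p hp q hq q' hq'
    obtain ⟨k, i, j, rfl⟩ := hp
    rw [contacts_barlowPos_eq_image hs] at hq hq'
    obtain ⟨x, hx, rfl⟩ := hq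
    obtain ⟨y, hy, rfl⟩ := hq'
    rw [Finset.mem_coe] at hx hy
    rw [dist_relPos_eq_iff_linkAdj hs one_pos sqrt_two_thirds_sq k i j
      (fst_mem_of_mem_linkOffsets hx) (fst_mem_of_mem_linkOffsets hy), hG, hG]
    have hL := hlink (fr (k, i, j))
    rw [hparm, hpar0] at hL
    exact (hL x hx y hy).symm

end DevelopCovering

/-! ## The stub -/

/-- **`stub_developCovering`** (ALGEBRAIC half of the model covering): a transport system on `S`
yields a Hägg word `s` (the parities `s k := par (V^k f₀)` along the vertical transport) and a
bond covering `Ψ` of `S` by the model `barlowStacking 1 √(2/3) s`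
(`Ψ (barlowPos 1 √(2/3) s k i j) := pt (V^k (J^j (I^i f₀)))`): onto by reachability,
star-bijective by the STAR clause read through `touching_iff_exists_linkOffsets`, link-faithful
by the LINK clause and `dist_relPos_eq_iff_linkAdj`. [folklore] -/
theorem stub_developCovering :
    ∀ S : Set E3, TransportSystem S → ∃ s : ℤ → ℤ, IsHaggSeq s ∧ ∃ Ψ : E3 → E3, IsBondCovering S s Ψ := by
  intro S hT
  obtain ⟨F, pt, I, J, V, par, f₀, hIJ, hIV, hJV, hpt, hpar, hparI, hparJ, hreach, hstar, hlink⟩ :=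
    hT
  -- the Hägg word: parities along the vertical transport
  obtain ⟨s, hs_eq⟩ : ∃ s : ℤ → ℤ, ∀ k, s k = par ((V ^ k) f₀) := ⟨_, fun _ => rfl⟩
  have hs : IsHaggSeq s := fun k => by rw [hs_eq]; exact hpar _
  -- the frames of the sites
  obtain ⟨fr, hfr⟩ : ∃ fr : ℤ × ℤ × ℤ → F, ∀ k i j, fr (k, i, j) = (V ^ k) ((J ^ j) ((I ^ i) f₀)) :=
    ⟨fun t => (V ^ t.1) ((J ^ t.2.2) ((I ^ t.2.1) f₀)), fun _ _ _ => rfl⟩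
  -- the covering map: a site goes to the point of its frame
  have hinj := DevelopCovering.barlowPos_triple_injective one_pos
    (Real.sqrt_pos.2 (by norm_num : (0 : ℝ) < 2 / 3)) s
  obtain ⟨Ψ, hΨ, hΨS⟩ : ∃ Ψ : E3 → E3,
      (∀ k i j, Ψ (barlowPos 1 (Real.sqrt (2 / 3)) s k i j) = pt (fr (k, i, j))) ∧
        ∀ q, Ψ q ∈ S := by
    refine ⟨fun q => pt (fr (Function.invFun
      (fun t : ℤ × ℤ × ℤ => barlowPos 1 (Real.sqrt (2 / 3)) s t.1 t.2.1 t.2.2) q)),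
      fun k i j => ?_, fun q => hpt _⟩
    have h1 := Function.leftInverse_invFun hinj (k, i, j)
    simp only at h1 ⊢
    rw [h1]
  refine ⟨s, hs, Ψ, DevelopCovering.isBondCovering_of_frames hs ?_ hstar hlink hΨ hΨS ?_ ?_ ?_⟩
  · -- reachability
    intro y hy
    obtain ⟨a, b, c, habc⟩ := hreach y hy
    exact ⟨(c, a, b), by rw [hfr]; exact habc⟩
  · -- shift rule
    intro k i j x
    rw [hfr, hfr, DevelopCovering.frame_shift hIJ hIV hJV, sub_eq_add_neg, sub_eq_add_neg]
  · -- parity of a frame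
    intro k i j
    rw [hfr, hs_eq, DevelopCovering.par_frame hIV hJV hparI hparJ]
  · -- parity of the frame below
    intro k i j
    rw [hfr, hs_eq, DevelopCovering.inv_apply_zpow_apply,
      DevelopCovering.par_frame hIV hJV hparI hparJ]

end Summit.AtomisticToContinuum.Crystallization.Theorems.PalmUnimodularRigidityShellsToBarlowChart

end
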